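import Summits.BirchSwinnertonDyer.Rank1Residual.AdditivePotMult.RamifiedOrdinaryLineTorsionFixedPotMult
import Summits.BirchSwinnertonDyer.Rank1Residual.Additive.GreenbergVatsalTransferCountThree
import HarnessLib

/-!
# GV's transfer count `#(S^{S₀}_{E₁[3^∞]}(ℚ_∞) ⊓ H¹[3]) = #(S^{S₀}_{E₂[3^∞]}(ℚ_∞) ⊓ H¹[3])` at the
# ADDITIVE prime `3` on the (M) rows and on MIXED (M) × (G-ord) pairs — the (M)-row TWINS of
# n1011-p12's FILE 8 `ClassX4Gord/ClassX3Gord.exists_data_natCard_gvSelmerInfty_inf_torsion_eq_three`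
# (cell `b2b-bsdres`, lane CLASS-CLOSURE, seat cc-typer-1 = typer of record N11 / O8, GEN 9; team n1011
# row T-E3g-GV29 (M) twins = p12 GEN 4 open item (i); p12's FILES 2/3/6/7/8 consumed BY NAME)

HONEST FRAMING (cell `b2b-bsdres`, run/shared/lean/b2b/bsd-rank1-residual/, verbatim in every
file): the goal of the cell is to DELETE the COMBINATION-SHAPED residual classes of the
Birch–Swinnerton-Dyer formula for ALL analytic-rank `≤ 1` elliptic curves over `ℚ` — "full BSD
formula for every rank `≤ 1` curve in class `C`" assembled STRICTLY from published theorems — so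
that the rank-`≤ 1` remainder becomes exactly the CONSTRUCTION-SHAPED classes, which are TYPED
(missing-input `Prop`s), NOT attempted. This is not "finishing BSD". Lane CLASS-CLOSURE: research
routes, no claim beyond the stated classes; census output = EVIDENCE, never a Literature fact;
NOTHING is booked here. THEOREMS ONLY: no definition, no named fact, no conjecture, no `sorry`.
The (M) rows carry the PUBLISHED Tate uniformisation A40/A41 (`hT40`, `hT41`) as hypotheses, exactly
as everywhere in the X2 / AdditivePotMult kernel; nothing else.

## What

* §1 `exists_data_natCard_gvSelmerInfty_inf_torsion_eq_three_of_flipped` — p12's FILE 8 argument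
  ABSTRACTED over the per-curve local package at the places `v ∋ 3` (a ramified ordinary line with
  `h0 / hfix / hmax`, as produced by FILE 7 on (G-ord) rows and by the prequel
  `RamifiedOrdinaryLineTorsionFixedPotMult` on (M) rows) and `3 ∤ #E_i(ℚ)_tors`: for `E₁[3] ≅ E₂[3]`
  (`TorsionIso`) and good reduction outside `S₀ ∪ {3}`, GV's count transfers.
* §2 class forms: **`PotMult.exists_data_natCard_gvSelmerInfty_inf_torsion_eq_three`** (pot-mult(3)
  pairs, `3 ∤ #E_i(ℚ)_tors` explicit), **`ClassX4M.…`** (X4(M) pairs; `3 ∤ #tors` from `Irr`),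
  **`ClassX3M.…`** (X3♯(M) pairs, REDUCIBLE `E_i[3]`, `3 ∤ #tors` explicit), and the MIXED congruence
  **`ClassX4M.exists_data_natCard_gvSelmerInfty_inf_torsion_eq_three_of_classX4Gord`** (one X4(M)
  row, one X4♯(G-ord) row — N11's CONG links across the (M)/(G-ord) boundary at `3`).

With this file GV p. 27 "the order of `S^{Σ₀}_{A_i[p]}(ℚ_∞)` is independent of `i`" holds in the
kernel at the additive prime `3` on EVERY `e = 2` row of the cell ((G-ord): p12, unconditional; (M):
here, mod A40/A41). What remains TYPED for a λ-transfer is unchanged (ROUTE-2 II.15.4: the LINK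
`Sel_{3^∞}(E/ℚ_∞) = S(ℚ_∞)` and GV Props (2.5)/(2.8)-second-half + Cor (2.3)). Nothing booked; no mark.

References: [GreenbergVatsal2000] §2 Prop. (2.8), Remark (2.9), pp. 26–27; [SilvermanATAEC1994]
V.5.3, V.5.4; ROUTE-2 II.15.4; class-closure/N11/TRANSPORT.md.
-/

set_option autoImplicit false

noncomputable section

open scoped Classical NumberField AddSubgroup

open NumberField IsDedekindDomain Field WeierstrassCurve
  Literature.NumberTheory.GaloisRepresentations Literature.NumberTheory.EllipticCurves
  Literature.NumberTheory.EllipticCurves.GreenbergSelmer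
  Literature.NumberTheory.EllipticCurves.EmertonPollackWeston2006
  Literature.NumberTheory.EllipticCurves.Rank1Residual
  Summit.BirchSwinnertonDyer.Rank1Residual.X2.TorsionComparison
  Summit.BirchSwinnertonDyer.Rank1Residual.X2.GreenbergVatsalTorsion
  Summit.BirchSwinnertonDyer.Rank1Residual.Additive.GreenbergVatsalTransferRamified
  Summit.BirchSwinnertonDyer.Rank1Residual.Additive

universe u

namespace Summit.BirchSwinnertonDyer.Rank1Residual.AdditivePotMult

open Summit.BirchSwinnertonDyer.Rank1Residual.X1.CongruenceTransfer (TorsionIso)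

section Three

variable {W₁ W₂ : WeierstrassCurve ℚ} [W₁.IsElliptic] [W₂.IsElliptic] (κ : ZpExtension ℚ 3)
  (S₀ : Set (HeightOneSpectrum (𝓞 ℚ)))

/-- **GV's transfer count at the additive prime `3`, from the per-curve FLIPPED-LINE packages** (p12's
FILE 8 argument, abstracted): if at every `v ∋ 3` each `E_i` carries a ramified ordinary line `C_i`
with `(E_i[3^∞]/C_i)^{ker κ ⊓ I_v} = 0`, `I_v` fixing `C_i ∩ E_i[3]` pointwise and `E_i[3]^{I_v} ⊆ C_i`,
if `3 ∤ #E_i(ℚ)_tors`, `E_i` is good outside `S₀ ∪ {3}`, and `E₁[3] ≅ E₂[3]`, then for some such data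
`#(S^{S₀}_{E₁[3^∞]}(ℚ_∞) ⊓ H¹[3]) = #(S^{S₀}_{E₂[3^∞]}(ℚ_∞) ⊓ H¹[3])`. Nothing booked.
[cite: GreenbergVatsal2000, §2 Prop. (2.8), Remark (2.9) and pp. 26–27] -/
theorem exists_data_natCard_gvSelmerInfty_inf_torsion_eq_three_of_flipped
    (h₁ : ∀ (v : HeightOneSpectrum (𝓞 ℚ)) (hv : ((3 : ℕ) : 𝓞 ℚ) ∈ v.asIdeal),
      ∃ L : LocalDatum ℚ ↥(W₁.geomPrimaryTorsion 3) v, IsRamifiedOrdinaryLine W₁ 3 L ∧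
        (∀ a ∈ invariants (inertiaIn κ.kerSubgroup v) L.Gr, a = 0) ∧
        (∀ τ ∈ inertia v, ∀ c ∈ (torsionDatum L 3).plus, τ • c = c) ∧
        (∀ x : (W₁.geomPrimaryTorsion 3)[((3 : ℕ) : ℤ)], (∀ τ ∈ inertia v, τ • x = x) →
          x ∈ (torsionDatum L 3).plus))
    (h₂ : ∀ (v : HeightOneSpectrum (𝓞 ℚ)) (hv : ((3 : ℕ) : 𝓞 ℚ) ∈ v.asIdeal),
      ∃ L : LocalDatum ℚ ↥(W₂.geomPrimaryTorsion 3) v, IsRamifiedOrdinaryLine W₂ 3 L ∧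
        (∀ a ∈ invariants (inertiaIn κ.kerSubgroup v) L.Gr, a = 0) ∧
        (∀ τ ∈ inertia v, ∀ c ∈ (torsionDatum L 3).plus, τ • c = c) ∧
        (∀ x : (W₂.geomPrimaryTorsion 3)[((3 : ℕ) : ℤ)], (∀ τ ∈ inertia v, τ • x = x) →
          x ∈ (torsionDatum L 3).plus))
    (hK₁ : ¬ 3 ∣ W₁.torsionOrder) (hK₂ : ¬ 3 ∣ W₂.torsionOrder)
    (hS₁ : ∀ v : HeightOneSpectrum (𝓞 ℚ), v ∉ S₀ → ((3 : ℕ) : 𝓞 ℚ) ∉ v.asIdeal →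
      W₁.HasGoodReductionAt v)
    (hS₂ : ∀ v : HeightOneSpectrum (𝓞 ℚ), v ∉ S₀ → ((3 : ℕ) : 𝓞 ℚ) ∉ v.asIdeal →
      W₂.HasGoodReductionAt v)
    (hT : TorsionIso W₁ W₂ 3) :
    ∃ (L₁ : Data ℚ (W₁.geomPrimaryTorsion 3) 3) (L₂ : Data ℚ (W₂.geomPrimaryTorsion 3) 3),
      (∀ v hv, IsRamifiedOrdinaryLine W₁ 3 (L₁ v hv)) ∧ (∀ v hv, IsRamifiedOrdinaryLine W₂ 3 (L₂ v hv)) ∧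
      Nat.card (gvSelmerInfty κ (W₁.geomPrimaryTorsion 3) L₁ S₀ ⊓
          (subgroupH1 κ.kerSubgroup (W₁.geomPrimaryTorsion 3))[((3 : ℕ) : ℤ)] :
          AddSubgroup (subgroupH1 κ.kerSubgroup (W₁.geomPrimaryTorsion 3))) =
        Nat.card (gvSelmerInfty κ (W₂.geomPrimaryTorsion 3) L₂ S₀ ⊓
          (subgroupH1 κ.kerSubgroup (W₂.geomPrimaryTorsion 3))[((3 : ℕ) : ℤ)] :
          AddSubgroup (subgroupH1 κ.kerSubgroup (W₂.geomPrimaryTorsion 3))) := by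
  choose L₁ hL₁ using h₁
  choose L₂ hL₂ using h₂
  obtain ⟨θ, hθ⟩ := X2.GreenbergVatsalTransferCurve.exists_equiv_of_torsionIso hT
  haveI := finite_fixedPoints_of_not_dvd_torsionOrder W₁ κ hK₁
  haveI := finite_fixedPoints_of_not_dvd_torsionOrder W₂ κ hK₂
  have h := natCard_gvSelmer_inf_torsion_mul_eq_curve_of_fixedPoints 3 κ.kerSubgroup W₁ W₂ L₁ L₂ S₀
    hS₁ hS₂ (fun v hv ↦ fun _ hm ↦ (hL₁ v hv).1.divisible hm)
    (fun v hv ↦ fun _ hm ↦ (hL₂ v hv).1.divisible hm)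
    (fun v hv ↦ (hL₁ v hv).2.1) (fun v hv ↦ (hL₂ v hv).2.1) (fun v hv ↦ (hL₁ v hv).2.2.1)
    (fun v hv ↦ (hL₂ v hv).2.2.1) (fun v hv ↦ (hL₁ v hv).2.2.2) (fun v hv ↦ (hL₂ v hv).2.2.2) θ hθ
  rw [natCard_torsionBy_fixedPoints_eq_one W₁ κ hK₁, natCard_torsionBy_fixedPoints_eq_one W₂ κ hK₂,
    mul_one, mul_one] at h
  exact ⟨L₁, L₂, fun v hv ↦ (hL₁ v hv).1, fun v hv ↦ (hL₂ v hv).1, h⟩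

/-- **GV's transfer count at the additive prime `3`, pot-mult(3) pairs** (mod A40/A41), with
`3 ∤ #E_i(ℚ)_tors` explicit (no image hypothesis): `E₁, E₂` potentially multiplicative at `3`, good
outside `S₀ ∪ {3}`, `E₁[3] ≅ E₂[3]`, `κ` ANY `ℤ_3`-extension: ramified ordinary data with
`#(S^{S₀}_{E₁[3^∞]}(ℚ_∞) ⊓ H¹[3]) = #(S^{S₀}_{E₂[3^∞]}(ℚ_∞) ⊓ H¹[3])`. Nothing booked.
[cite: GreenbergVatsal2000, §2 Prop. (2.8), Remark (2.9) and pp. 26–27]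
[cite: SilvermanATAEC1994, V.5.3 and V.5.4 (Tate uniformisation)] -/
theorem PotMult.exists_data_natCard_gvSelmerInfty_inf_torsion_eq_three
    (hT40 : Silverman1994_thmV53_tateUniformisation.{0})
    (hT41 : Silverman1994_thmV53_corV54_tateUniformisation.{0})
    (hpm₁ : PotMult W₁ 3) (hpm₂ : PotMult W₂ 3)
    (htors₁ : ¬ 3 ∣ W₁.torsionOrder) (htors₂ : ¬ 3 ∣ W₂.torsionOrder)
    (hS₁ : ∀ v : HeightOneSpectrum (𝓞 ℚ), v ∉ S₀ → ((3 : ℕ) : 𝓞 ℚ) ∉ v.asIdeal →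
      W₁.HasGoodReductionAt v)
    (hS₂ : ∀ v : HeightOneSpectrum (𝓞 ℚ), v ∉ S₀ → ((3 : ℕ) : 𝓞 ℚ) ∉ v.asIdeal →
      W₂.HasGoodReductionAt v)
    (hT : TorsionIso W₁ W₂ 3) :
    ∃ (L₁ : Data ℚ (W₁.geomPrimaryTorsion 3) 3) (L₂ : Data ℚ (W₂.geomPrimaryTorsion 3) 3),
      (∀ v hv, IsRamifiedOrdinaryLine W₁ 3 (L₁ v hv)) ∧ (∀ v hv, IsRamifiedOrdinaryLine W₂ 3 (L₂ v hv)) ∧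
      Nat.card (gvSelmerInfty κ (W₁.geomPrimaryTorsion 3) L₁ S₀ ⊓
          (subgroupH1 κ.kerSubgroup (W₁.geomPrimaryTorsion 3))[((3 : ℕ) : ℤ)] :
          AddSubgroup (subgroupH1 κ.kerSubgroup (W₁.geomPrimaryTorsion 3))) =
        Nat.card (gvSelmerInfty κ (W₂.geomPrimaryTorsion 3) L₂ S₀ ⊓
          (subgroupH1 κ.kerSubgroup (W₂.geomPrimaryTorsion 3))[((3 : ℕ) : ℤ)] :
          AddSubgroup (subgroupH1 κ.kerSubgroup (W₂.geomPrimaryTorsion 3))) :=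
  exists_data_natCard_gvSelmerInfty_inf_torsion_eq_three_of_flipped κ S₀
    (fun _ hv ↦ hpm₁.exists_isRamifiedOrdinaryLine_flipped_three κ hT40 hT41 hv)
    (fun _ hv ↦ hpm₂.exists_isRamifiedOrdinaryLine_flipped_three κ hT40 hT41 hv)
    htors₁ htors₂ hS₁ hS₂ hT

/-- **GV's transfer count at the additive prime `3`, X4(M) pairs — the (M) TWIN of p12's
`ClassX4Gord.exists_data_natCard_gvSelmerInfty_inf_torsion_eq_three`** (mod A40/A41): `E₁, E₂ ∈` X4(M)
at `3`, good outside `S₀ ∪ {3}`, `E₁[3] ≅ E₂[3]`, `κ` ANY `ℤ_3`-extension (`3 ∤ #tors` from `Irr`).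
X4(M) stays CONSTRUCTION-SHAPED; nothing booked.
[cite: GreenbergVatsal2000, §2 Prop. (2.8), Remark (2.9) and pp. 26–27]
[cite: SilvermanATAEC1994, V.5.3 and V.5.4 (Tate uniformisation)] -/
theorem ClassX4M.exists_data_natCard_gvSelmerInfty_inf_torsion_eq_three
    (hT40 : Silverman1994_thmV53_tateUniformisation.{0})
    (hT41 : Silverman1994_thmV53_corV54_tateUniformisation.{0})
    (hX₁ : ClassX4M W₁ 3) (hX₂ : ClassX4M W₂ 3)
    (hS₁ : ∀ v : HeightOneSpectrum (𝓞 ℚ), v ∉ S₀ → ((3 : ℕ) : 𝓞 ℚ) ∉ v.asIdeal →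
      W₁.HasGoodReductionAt v)
    (hS₂ : ∀ v : HeightOneSpectrum (𝓞 ℚ), v ∉ S₀ → ((3 : ℕ) : 𝓞 ℚ) ∉ v.asIdeal →
      W₂.HasGoodReductionAt v)
    (hT : TorsionIso W₁ W₂ 3) :
    ∃ (L₁ : Data ℚ (W₁.geomPrimaryTorsion 3) 3) (L₂ : Data ℚ (W₂.geomPrimaryTorsion 3) 3),
      (∀ v hv, IsRamifiedOrdinaryLine W₁ 3 (L₁ v hv)) ∧ (∀ v hv, IsRamifiedOrdinaryLine W₂ 3 (L₂ v hv)) ∧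
      Nat.card (gvSelmerInfty κ (W₁.geomPrimaryTorsion 3) L₁ S₀ ⊓
          (subgroupH1 κ.kerSubgroup (W₁.geomPrimaryTorsion 3))[((3 : ℕ) : ℤ)] :
          AddSubgroup (subgroupH1 κ.kerSubgroup (W₁.geomPrimaryTorsion 3))) =
        Nat.card (gvSelmerInfty κ (W₂.geomPrimaryTorsion 3) L₂ S₀ ⊓
          (subgroupH1 κ.kerSubgroup (W₂.geomPrimaryTorsion 3))[((3 : ℕ) : ℤ)] :
          AddSubgroup (subgroupH1 κ.kerSubgroup (W₂.geomPrimaryTorsion 3))) :=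
  PotMult.exists_data_natCard_gvSelmerInfty_inf_torsion_eq_three κ S₀ hT40 hT41
    (ClassX4M.potMult W₁ 3 hX₁) (ClassX4M.potMult W₂ 3 hX₂)
    (not_dvd_torsionOrder_of_irr' 3 W₁ (ClassX4M.irr W₁ 3 hX₁))
    (not_dvd_torsionOrder_of_irr' 3 W₂ (ClassX4M.irr W₂ 3 hX₂)) hS₁ hS₂ hT

/-- **GV's transfer count at the additive prime `3`, X3♯(M) pairs (REDUCIBLE `E_i[3]`) — the (M) TWIN
of p12's `ClassX3Gord.exists_data_natCard_gvSelmerInfty_inf_torsion_eq_three`** (mod A40/A41), with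
`3 ∤ #E_i(ℚ)_tors` explicit (the X3 rows' census bit). X3♯(M) stays as labelled; nothing booked.
[cite: GreenbergVatsal2000, §2 Prop. (2.8), Remark (2.9) and pp. 26–27]
[cite: SilvermanATAEC1994, V.5.3 and V.5.4 (Tate uniformisation)] -/
theorem ClassX3M.exists_data_natCard_gvSelmerInfty_inf_torsion_eq_three
    [W₁.IsGloballyMinimal] [W₂.IsGloballyMinimal]
    (hT40 : Silverman1994_thmV53_tateUniformisation.{0})
    (hT41 : Silverman1994_thmV53_corV54_tateUniformisation.{0})
    (hX₁ : ClassX3M W₁ 3) (hX₂ : ClassX3M W₂ 3)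
    (htors₁ : ¬ 3 ∣ W₁.torsionOrder) (htors₂ : ¬ 3 ∣ W₂.torsionOrder)
    (hS₁ : ∀ v : HeightOneSpectrum (𝓞 ℚ), v ∉ S₀ → ((3 : ℕ) : 𝓞 ℚ) ∉ v.asIdeal →
      W₁.HasGoodReductionAt v)
    (hS₂ : ∀ v : HeightOneSpectrum (𝓞 ℚ), v ∉ S₀ → ((3 : ℕ) : 𝓞 ℚ) ∉ v.asIdeal →
      W₂.HasGoodReductionAt v)
    (hT : TorsionIso W₁ W₂ 3) :
    ∃ (L₁ : Data ℚ (W₁.geomPrimaryTorsion 3) 3) (L₂ : Data ℚ (W₂.geomPrimaryTorsion 3) 3),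
      (∀ v hv, IsRamifiedOrdinaryLine W₁ 3 (L₁ v hv)) ∧ (∀ v hv, IsRamifiedOrdinaryLine W₂ 3 (L₂ v hv)) ∧
      Nat.card (gvSelmerInfty κ (W₁.geomPrimaryTorsion 3) L₁ S₀ ⊓
          (subgroupH1 κ.kerSubgroup (W₁.geomPrimaryTorsion 3))[((3 : ℕ) : ℤ)] :
          AddSubgroup (subgroupH1 κ.kerSubgroup (W₁.geomPrimaryTorsion 3))) =
        Nat.card (gvSelmerInfty κ (W₂.geomPrimaryTorsion 3) L₂ S₀ ⊓
          (subgroupH1 κ.kerSubgroup (W₂.geomPrimaryTorsion 3))[((3 : ℕ) : ℤ)] :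
          AddSubgroup (subgroupH1 κ.kerSubgroup (W₂.geomPrimaryTorsion 3))) :=
  PotMult.exists_data_natCard_gvSelmerInfty_inf_torsion_eq_three κ S₀ hT40 hT41
    (ClassX3M.potMult W₁ 3 hX₁) (ClassX3M.potMult W₂ 3 hX₂) htors₁ htors₂ hS₁ hS₂ hT

/-- **GV's transfer count at the additive prime `3` across the (M)/(G-ord) boundary: one X4(M) row and
one X4♯(G-ord) row with `E₁[3] ≅ E₂[3]`** (the (M) side mod A40/A41, the (G-ord) side p12's
unconditional FILE 7) — N11's mod-`3` congruence links between the two `e = 2` kinds. Both classes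
stay CONSTRUCTION-SHAPED; nothing booked.
[cite: GreenbergVatsal2000, §2 Prop. (2.8), Remark (2.9) and pp. 26–27]
[cite: SilvermanATAEC1994, V.5.3 and V.5.4 (Tate uniformisation)] -/
theorem ClassX4M.exists_data_natCard_gvSelmerInfty_inf_torsion_eq_three_of_classX4Gord
    [W₂.IsGloballyMinimal]
    (hT40 : Silverman1994_thmV53_tateUniformisation.{0})
    (hT41 : Silverman1994_thmV53_corV54_tateUniformisation.{0})
    (hX₁ : ClassX4M W₁ 3) (hX₂ : ClassX4Gord W₂ 3)
    (hS₁ : ∀ v : HeightOneSpectrum (𝓞 ℚ), v ∉ S₀ → ((3 : ℕ) : 𝓞 ℚ) ∉ v.asIdeal →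
      W₁.HasGoodReductionAt v)
    (hS₂ : ∀ v : HeightOneSpectrum (𝓞 ℚ), v ∉ S₀ → ((3 : ℕ) : 𝓞 ℚ) ∉ v.asIdeal →
      W₂.HasGoodReductionAt v)
    (hT : TorsionIso W₁ W₂ 3) :
    ∃ (L₁ : Data ℚ (W₁.geomPrimaryTorsion 3) 3) (L₂ : Data ℚ (W₂.geomPrimaryTorsion 3) 3),
      (∀ v hv, IsRamifiedOrdinaryLine W₁ 3 (L₁ v hv)) ∧ (∀ v hv, IsRamifiedOrdinaryLine W₂ 3 (L₂ v hv)) ∧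
      Nat.card (gvSelmerInfty κ (W₁.geomPrimaryTorsion 3) L₁ S₀ ⊓
          (subgroupH1 κ.kerSubgroup (W₁.geomPrimaryTorsion 3))[((3 : ℕ) : ℤ)] :
          AddSubgroup (subgroupH1 κ.kerSubgroup (W₁.geomPrimaryTorsion 3))) =
        Nat.card (gvSelmerInfty κ (W₂.geomPrimaryTorsion 3) L₂ S₀ ⊓
          (subgroupH1 κ.kerSubgroup (W₂.geomPrimaryTorsion 3))[((3 : ℕ) : ℤ)] :
          AddSubgroup (subgroupH1 κ.kerSubgroup (W₂.geomPrimaryTorsion 3))) :=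
  exists_data_natCard_gvSelmerInfty_inf_torsion_eq_three_of_flipped κ S₀
    (fun _ hv ↦ hX₁.exists_isRamifiedOrdinaryLine_flipped_three κ hT40 hT41 hv)
    (fun _ hv ↦ ClassX4Gord.exists_isRamifiedOrdinaryLine_flipped_three κ hX₂ hv)
    (not_dvd_torsionOrder_of_irr' 3 W₁ (ClassX4M.irr W₁ 3 hX₁))
    (not_dvd_torsionOrder_of_irr' 3 W₂ hX₂.1.2.2) hS₁ hS₂ hT

end Three

end Summit.BirchSwinnertonDyer.Rank1Residual.AdditivePotMult

end
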